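import Literature.NumberTheory.LFunctions.CardonRobertsZeros
import HarnessLib

/-!
# RH-FREE · Markov–Stieltjes separation of the zeros of the Cardon–Roberts polynomials from the support (CR Lemma 3.3: `a_k < x_{n,k}`) and the extremal property of `p_{2n}/p_{2n}(0)`, `p_{2n+1}/(x p'_{2n+1}(0))` — nothing here bears on the truth of RH

Literature-typing tranche `rh-lit-broughan-2` (Broughan, *Equivalents of the Riemann Hypothesis*
Vol. 2, Ch. 6, §§6.3–6.4; Cardon–Roberts 2006, Lemmas 2.5 and 3.3). Third layer of the proof of
the tree's named fact `CardonRoberts2006_lemma_3_5` (Broughan Thm 6.16), for a general measure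
`μ` on `ℝ` (hypotheses `hmom`, `hae`, `hsym` of `CardonRobertsOrthogonality`):

* `CardonRobertsOP.card_filter_le_of_orthogonal` — the **separation theorem in counting form**
  (CR Lemma 2.5 / Lemma 3.3 "`a_k < x_{nk}`", Szegő Thm 3.41.2, here à la Chebyshev–Markov–
  Stieltjes): if `P = Xᵉ ∏_{x ∈ Z} (X² − x²)` (`e ≤ 1`, `Z ⊂ (0,∞)` finite) is `μ`-orthogonal to
  all polynomials of smaller degree and `μ` is carried by `{y : |y| ∈ S}`, then for every `t` the
  number of `x ∈ Z` with `x ≤ t` is at most the number of points of `S` in `[0, t)`. Proof: with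
  `F' = S ∩ [0,t)` and `h = Xᵉ ∏_{s ∈ F'} (X² − s²) ∏_{x ∈ Z, x > t} (X² − x²)`, the product `P h`
  is `≥ 0` on the support and `P ⟂ h` as soon as `#F' < #{x ∈ Z : x ≤ t}`, contradicting
  `∫ P h dμ > 0`. Specialisations `card_filter_le_even` / `card_filter_le_odd` to `p_{2n}`,
  `p_{2n+1}`.
* `CardonRobertsOP.coeff_one_prod_X_sq_sub` — `∏ (X² − x²)` has no linear term.
* `CardonRobertsOP.integral_evenRatio_sq_le` — **extremal property of `P_n = p_{2n}/p_{2n}(0)`**: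
  for every polynomial `T` of degree `< 2n`,
  `∫ (P_n(x)/x)² dμ ≤ ∫ ((1 − x² T(x))/x)² dμ` (i.e. `(1 − P_n)/x²` is the `L²(x² dμ)`-projection
  of `1/x²` onto polynomials of degree `< 2n`; orthogonality of `p_{2n}` to lower degrees);
  `CardonRobertsOP.integral_oddRatio_sq_le` — the same for `O_n = p_{2n+1}/(x p'_{2n+1}(0))` in
  `L²(x⁴ dμ)`: `∫ O_n(x)² dμ ≤ ∫ (1 − x² T(x))² dμ`.
  These replace, in the tree's road to Lemma 3.5, CR's use of the determinacy of the Hamburger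
  moment problem (CR Lemma 3.2 / Lemma 2.6): combined with the density of polynomials in
  `L²(x² dμ)`, `L²(x⁴ dμ)` they give `P_n(a) → 0`, `O_n(a) → 0` at every support point `a`.

No new definitions, no named facts (D-0026); standard axioms only; nothing here bears on the
truth of RH.

## References

* [CardonRoberts2006] D. A. Cardon, S. A. Roberts, J. Approx. Theory 138 (2006) 54–64: Lemma 2.5
  p. 57 (Szegő Thm 3.41.2 / Chihara Thm II.4.1), Lemma 3.3 p. 61.
* [Broughan2017] K. Broughan, *Equivalents of the Riemann Hypothesis* Vol. 2, CUP 2017, §6.3.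
* G. Szegő, *Orthogonal Polynomials*, §3.41 (Chebyshev–Markov–Stieltjes separation theorem).
-/

noncomputable section

open MeasureTheory Polynomial Filter

namespace Literature.NumberTheory.LFunctions

namespace CardonRobertsOP

variable {μ : Measure ℝ}

/-! ## §1 Degrees and values of the products `Xᵉ ∏ (X² − x²)` -/

/-- `∏_{x ∈ Z} (X² − x²)` is monic. [cite: CardonRoberts2006, (17) p. 61] -/
theorem monic_prod_X_sq_sub (Z : Finset ℝ) : (∏ x ∈ Z, (X ^ 2 - C (x ^ 2) : ℝ[X])).Monic :=
  monic_prod_of_monic _ _ fun _ _ ↦ monic_X_pow_sub_C _ two_ne_zero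

/-- `natDegree ∏_{x ∈ Z} (X² − x²) = 2 · #Z`. [cite: CardonRoberts2006, (17) p. 61] -/
theorem natDegree_prod_X_sq_sub (Z : Finset ℝ) :
    (∏ x ∈ Z, (X ^ 2 - C (x ^ 2) : ℝ[X])).natDegree = 2 * Z.card := by
  rw [natDegree_prod_of_monic _ _ (fun _ _ ↦ monic_X_pow_sub_C _ two_ne_zero)]
  simp only [natDegree_X_pow_sub_C, Finset.sum_const, smul_eq_mul, mul_comm]

/-- `natDegree (Xᵉ ∏_{x ∈ Z} (X² − x²)) = e + 2 · #Z`. [cite: CardonRoberts2006, (17) p. 61] -/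
theorem natDegree_X_pow_mul_prod (e : ℕ) (Z : Finset ℝ) :
    (X ^ e * ∏ x ∈ Z, (X ^ 2 - C (x ^ 2)) : ℝ[X]).natDegree = e + 2 * Z.card := by
  rw [(monic_X_pow e).natDegree_mul (monic_prod_X_sq_sub Z), natDegree_X_pow,
    natDegree_prod_X_sq_sub]

/-- Real evaluation: `(∏_{x ∈ Z} (X² − x²))(y) = ∏ (y² − x²)`. [cite: CardonRoberts2006, (17) p. 61] -/
theorem eval_prod_X_sq_sub (Z : Finset ℝ) (y : ℝ) :
    (∏ x ∈ Z, (X ^ 2 - C (x ^ 2) : ℝ[X])).eval y = ∏ x ∈ Z, (y ^ 2 - x ^ 2) := by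
  rw [eval_prod]
  refine Finset.prod_congr rfl fun x _ ↦ ?_
  simp

/-- The linear coefficient of `∏_{x ∈ Z} (X² − x²)` vanishes (a polynomial in `X²`).
[cite: CardonRoberts2006, (17) p. 61] -/
theorem coeff_one_prod_X_sq_sub (Z : Finset ℝ) :
    (∏ x ∈ Z, (X ^ 2 - C (x ^ 2) : ℝ[X])).coeff 1 = 0 := by
  classical
  induction Z using Finset.induction_on with
  | empty => simp [coeff_one]
  | insert a Z ha ih =>
    have hlin : (X ^ 2 - C (a ^ 2) : ℝ[X]).coeff 1 = 0 := by
      rw [coeff_sub, coeff_X_pow, coeff_C, if_neg (by norm_num), if_neg (by norm_num), sub_zero]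
    rw [Finset.prod_insert ha, coeff_mul, Finset.Nat.sum_antidiagonal_succ,
      Finset.Nat.antidiagonal_zero, Finset.sum_singleton, ih, mul_zero, zero_add, zero_add, hlin,
      zero_mul]

/-! ## §2 The separation theorem (counting form) -/

/-- **Separation of zeros by the support, counting form** (CR Lemma 2.5 / Lemma 3.3, Chebyshev–
Markov–Stieltjes). Let `P = Xᵉ ∏_{x ∈ Z} (X² − x²)` with `Z` a finite set of positive
reals, `μ`-orthogonal to every polynomial of smaller degree, and let `μ` be carried by
`{y : |y| ∈ S}`. Then for every real `t` and every finite `F ⊇ S ∩ (−∞, t)`: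
`#{x ∈ Z : x ≤ t} ≤ #{a ∈ F : 0 ≤ a < t}` — at least `k` support points lie in `[0, x_k)` below
the `k`-th positive zero. [cite: CardonRoberts2006, Lemma 3.3 p. 61] -/
theorem card_filter_le_of_orthogonal (hmom : ∀ m : ℕ, Integrable (fun x : ℝ ↦ x ^ m) μ)
    (hae : ∀ p : ℝ[X], (fun x : ℝ ↦ p.eval x) =ᵐ[μ] 0 → p = 0)
    {e : ℕ} {Z : Finset ℝ} (hZ : ∀ x ∈ Z, 0 < x)
    (horth : ∀ q : ℝ[X], q.natDegree < e + 2 * Z.card →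
      cardonRobertsInner μ (X ^ e * ∏ x ∈ Z, (X ^ 2 - C (x ^ 2))) q = 0)
    {S : Set ℝ} (hS : ∀ᵐ y ∂μ, |y| ∈ S) (t : ℝ) (F : Finset ℝ)
    (hF : ∀ a ∈ S, a < t → a ∈ F) :
    (Z.filter (fun x ↦ x ≤ t)).card ≤ (F.filter (fun a ↦ 0 ≤ a ∧ a < t)).card := by
  classical
  by_contra hlt
  push Not at hlt
  set F' := F.filter (fun a ↦ 0 ≤ a ∧ a < t) with hF'
  set Zle := Z.filter (fun x ↦ x ≤ t) with hZle
  set Zgt := Z.filter (fun x ↦ ¬ x ≤ t) with hZgt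
  set P : ℝ[X] := X ^ e * ∏ x ∈ Z, (X ^ 2 - C (x ^ 2)) with hP
  set h : ℝ[X] := X ^ e * ((∏ s ∈ F', (X ^ 2 - C (s ^ 2))) * ∏ x ∈ Zgt, (X ^ 2 - C (x ^ 2)))
    with hh
  have hcardZ : Z.card = Zle.card + Zgt.card :=
    (Finset.card_filter_add_card_filter_not (s := Z) (fun x : ℝ ↦ x ≤ t)).symm
  -- `deg h < deg P`
  have hhmonic : h.Monic :=
    (monic_X_pow e).mul ((monic_prod_X_sq_sub F').mul (monic_prod_X_sq_sub Zgt))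
  have hhdeg : h.natDegree = e + 2 * F'.card + 2 * Zgt.card := by
    rw [hh, (monic_X_pow e).natDegree_mul ((monic_prod_X_sq_sub F').mul (monic_prod_X_sq_sub Zgt)),
      (monic_prod_X_sq_sub F').natDegree_mul (monic_prod_X_sq_sub Zgt), natDegree_X_pow,
      natDegree_prod_X_sq_sub, natDegree_prod_X_sq_sub]
    ring
  have hlt' : h.natDegree < e + 2 * Z.card := by rw [hhdeg, hcardZ]; omega
  have h0 : cardonRobertsInner μ P h = 0 := horth h hlt'
  -- `P h ≥ 0` on the support
  have hPne : P ≠ 0 := ((monic_X_pow e).mul (monic_prod_X_sq_sub Z)).ne_zero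
  have hnonneg : 0 ≤ᵐ[μ] fun y : ℝ ↦ (P * h).eval y := by
    filter_upwards [hS] with y hy
    have hPy : P.eval y = y ^ e * ((∏ x ∈ Zle, (y ^ 2 - x ^ 2)) * ∏ x ∈ Zgt, (y ^ 2 - x ^ 2)) := by
      rw [hP, eval_mul, eval_pow, eval_X, eval_prod_X_sq_sub, hZle, hZgt,
        Finset.prod_filter_mul_prod_filter_not]
    have hhy : h.eval y = y ^ e * ((∏ s ∈ F', (y ^ 2 - s ^ 2)) * ∏ x ∈ Zgt, (y ^ 2 - x ^ 2)) := by
      rw [hh, eval_mul, eval_pow, eval_X, eval_mul, eval_prod_X_sq_sub, eval_prod_X_sq_sub]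
    have hrw : (P * h).eval y = (y ^ e) ^ 2 * (∏ x ∈ Zle, (y ^ 2 - x ^ 2)) *
        (∏ s ∈ F', (y ^ 2 - s ^ 2)) * (∏ x ∈ Zgt, (y ^ 2 - x ^ 2)) ^ 2 := by
      rw [eval_mul, hPy, hhy]; ring
    rw [hrw]
    by_cases hyt : t ≤ |y|
    · -- every factor is nonnegative
      refine mul_nonneg (mul_nonneg (mul_nonneg (sq_nonneg _)
        (Finset.prod_nonneg fun x hx ↦ ?_)) (Finset.prod_nonneg fun s hs ↦ ?_)) (sq_nonneg _)
      · have hx := (Finset.mem_filter.1 hx)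
        have hxpos := hZ x hx.1
        have hxy : x ≤ |y| := hx.2.trans hyt
        nlinarith [sq_abs y, abs_nonneg y]
      · have hs' := (Finset.mem_filter.1 hs).2
        have hsy : s ≤ |y| := hs'.2.le.trans hyt
        nlinarith [sq_abs y, abs_nonneg y]
    · -- `|y|` is a support point below `t`, hence in `F'`, and its factor vanishes
      have hyt' : |y| < t := not_le.1 hyt
      have hmem : |y| ∈ F' := by
        rw [hF', Finset.mem_filter]
        exact ⟨hF _ hy hyt', abs_nonneg y, hyt'⟩
      have hzero : ∏ s ∈ F', (y ^ 2 - s ^ 2) = 0 :=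
        Finset.prod_eq_zero hmem (by rw [sq_abs, sub_self])
      rw [hzero]
      simp
  have hpos : 0 < cardonRobertsInner μ P h := by
    rw [inner_eq_integral_mul]
    exact integral_pos_of_nonneg_ae hmom hae (mul_ne_zero hPne hhmonic.ne_zero) hnonneg
  exact hpos.ne' h0

/-- **CR Lemma 3.3, even case** (counting form): if `μ` is carried by `{y : |y| ∈ S}`, then for
the set `Z` of positive zeros of `p_{2n}` and every `t`, `#{x ∈ Z : x ≤ t} ≤ #(S ∩ [0,t))`
(for any finite `F ⊇ S ∩ (−∞,t)`): "`a_k < x_{2n,k}`". [cite: CardonRoberts2006, Lemma 3.3 p. 61] -/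
theorem card_filter_le_even (hmom : ∀ m : ℕ, Integrable (fun x : ℝ ↦ x ^ m) μ)
    (hae : ∀ p : ℝ[X], (fun x : ℝ ↦ p.eval x) =ᵐ[μ] 0 → p = 0) {n : ℕ} {Z : Finset ℝ}
    (hZ : ∀ x ∈ Z, 0 < x) (hcard : Z.card = n)
    (hprod : cardonRobertsPoly μ (2 * n) = ∏ x ∈ Z, (X ^ 2 - C (x ^ 2)))
    {S : Set ℝ} (hS : ∀ᵐ y ∂μ, |y| ∈ S) (t : ℝ) (F : Finset ℝ)
    (hF : ∀ a ∈ S, a < t → a ∈ F) :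
    (Z.filter (fun x ↦ x ≤ t)).card ≤ (F.filter (fun a ↦ 0 ≤ a ∧ a < t)).card := by
  refine card_filter_le_of_orthogonal hmom hae (e := 0) hZ (fun q hq ↦ ?_) hS t F hF
  rw [pow_zero, one_mul, ← hprod]
  refine inner_eq_zero_of_degree_lt hmom hae ?_
  by_cases hq0 : q = 0
  · rw [hq0, degree_zero]; exact WithBot.bot_lt_coe _
  · rw [degree_eq_natDegree hq0]
    exact_mod_cast (by omega : q.natDegree < 2 * n)

/-- **CR Lemma 3.3, odd case** (counting form): the same for the positive zeros of `p_{2n+1}`: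
"`a_k < x_{2n+1,k}`". [cite: CardonRoberts2006, Lemma 3.3 p. 61] -/
theorem card_filter_le_odd (hmom : ∀ m : ℕ, Integrable (fun x : ℝ ↦ x ^ m) μ)
    (hae : ∀ p : ℝ[X], (fun x : ℝ ↦ p.eval x) =ᵐ[μ] 0 → p = 0) {n : ℕ} {Z : Finset ℝ}
    (hZ : ∀ x ∈ Z, 0 < x) (hcard : Z.card = n)
    (hprod : cardonRobertsPoly μ (2 * n + 1) = X * ∏ x ∈ Z, (X ^ 2 - C (x ^ 2)))
    {S : Set ℝ} (hS : ∀ᵐ y ∂μ, |y| ∈ S) (t : ℝ) (F : Finset ℝ)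
    (hF : ∀ a ∈ S, a < t → a ∈ F) :
    (Z.filter (fun x ↦ x ≤ t)).card ≤ (F.filter (fun a ↦ 0 ≤ a ∧ a < t)).card := by
  refine card_filter_le_of_orthogonal hmom hae (e := 1) hZ (fun q hq ↦ ?_) hS t F hF
  rw [pow_one, ← hprod]
  refine inner_eq_zero_of_degree_lt hmom hae ?_
  by_cases hq0 : q = 0
  · rw [hq0, degree_zero]; exact WithBot.bot_lt_coe _
  · rw [degree_eq_natDegree hq0]
    exact_mod_cast (by omega : q.natDegree < 2 * n + 1)

/-! ## §3 The extremal property of the normalised polynomials -/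

/-- Bookkeeping: if `T` has degree `< 2n` then `natDegree (1 − X² T) ≤ 2n + 1`.
[cite: CardonRoberts2006, Lemma 3.5 p. 62 (bookkeeping)] -/
theorem natDegree_one_sub_X_sq_mul_le {n : ℕ} {T : ℝ[X]} (hT : T.degree < (2 * n : ℕ)) :
    (1 - X ^ 2 * T : ℝ[X]).natDegree ≤ 2 * n + 1 := by
  refine (natDegree_sub_le _ _).trans (max_le (by simp) ?_)
  by_cases hT0 : T = 0
  · simp [hT0]
  · have hTn : T.natDegree < 2 * n := (natDegree_lt_iff_degree_lt hT0).2 hT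
    calc (X ^ 2 * T : ℝ[X]).natDegree ≤ (X ^ 2 : ℝ[X]).natDegree + T.natDegree := natDegree_mul_le
      _ ≤ 2 * n + 1 := by rw [natDegree_X_pow]; omega

/-- Bookkeeping: from `X² E = D` with `natDegree D ≤ 2n + 1`, `deg E < 2n`.
[cite: CardonRoberts2006, Lemma 3.5 p. 62 (bookkeeping)] -/
theorem degree_lt_of_X_sq_mul_eq {n : ℕ} {D E : ℝ[X]} (hDE : D = X ^ 2 * E)
    (hD : D.natDegree ≤ 2 * n + 1) : E.degree < (2 * n : ℕ) := by
  by_cases hE : E = 0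
  · rw [hE, degree_zero]; exact WithBot.bot_lt_coe _
  · have hX : (X ^ 2 : ℝ[X]) ≠ 0 := pow_ne_zero _ X_ne_zero
    have h1 : D.natDegree = 2 + E.natDegree := by
      rw [hDE, natDegree_mul hX hE, natDegree_X_pow]
    rw [degree_eq_natDegree hE]
    exact_mod_cast (by omega : E.natDegree < 2 * n)

/-- **Extremal property of `P_n = p_{2n}/p_{2n}(0)`** (symmetric `μ` kept at distance `δ > 0`
from the origin): for every polynomial `T` of degree `< 2n`,
`∫ (p_{2n}(x)/(x p_{2n}(0)))² dμ ≤ ∫ ((1 − x² T(x))/x)² dμ`. Indeed `1 − X²T − P_n = X² E` with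
`deg E < 2n`, so the cross term `2 ∫ P_n E dμ` vanishes by orthogonality and the difference of the
two sides is `∫ x² E(x)² dμ ≥ 0`. (Replaces CR's appeal to the determinacy of the moment problem,
Lemma 3.2, on the tree's road to Lemma 3.5.) [cite: CardonRoberts2006, Lemma 3.4 p. 61–62 (tree's substitute road)] -/
theorem integral_evenRatio_sq_le (hmom : ∀ m : ℕ, Integrable (fun x : ℝ ↦ x ^ m) μ)
    (hae : ∀ p : ℝ[X], (fun x : ℝ ↦ p.eval x) =ᵐ[μ] 0 → p = 0)
    (hsym : ∀ p : ℝ[X], ∫ x, p.eval (-x) ∂μ = ∫ x, p.eval x ∂μ)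
    {δ : ℝ} (hδ : 0 < δ) (hgap : ∀ᵐ x ∂μ, δ ≤ |x|) (n : ℕ) (T : ℝ[X])
    (hT : T.degree < (2 * n : ℕ)) :
    ∫ x, ((cardonRobertsPoly μ (2 * n)).eval x / (x * (cardonRobertsPoly μ (2 * n)).eval 0)) ^ 2 ∂μ
      ≤ ∫ x, ((1 - x ^ 2 * T.eval x) / x) ^ 2 ∂μ := by
  obtain ⟨Z, hcard, hpos, -, hprod, h0ne, -⟩ := exists_evenRatio_eq_prod hmom hae hsym n
  set p := cardonRobertsPoly μ (2 * n) with hp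
  set c : ℝ := (p.eval 0)⁻¹ with hc
  set Pn : ℝ[X] := C c * p with hPn
  set Q : ℝ[X] := 1 - X ^ 2 * T with hQ
  -- `X² ∣ Q − Pn`
  have hp1 : p.coeff 1 = 0 := by rw [hprod]; exact coeff_one_prod_X_sq_sub Z
  have hdvd : (X : ℝ[X]) ^ 2 ∣ Q - Pn := by
    rw [X_pow_dvd_iff]
    intro d hd
    interval_cases d
    · rw [coeff_sub, hQ, hPn, coeff_sub, coeff_one_zero, coeff_X_pow_mul', if_neg (by omega),
        sub_zero, coeff_C_mul, coeff_zero_eq_eval_zero, hc, inv_mul_cancel₀ h0ne, sub_self]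
    · rw [coeff_sub, hQ, hPn, coeff_sub, coeff_one, if_neg one_ne_zero, coeff_X_pow_mul',
        if_neg (by omega), sub_zero, coeff_C_mul, hp1, mul_zero, sub_zero]
  obtain ⟨E, hE⟩ := hdvd
  -- `deg E < 2n`, hence `⟨p, E⟩ = 0`
  have hPndeg : Pn.natDegree ≤ 2 * n := by
    rw [hPn]
    refine (natDegree_C_mul_le _ _).trans ?_
    rw [natDegree_eq]
  have hDdeg : (Q - Pn).natDegree ≤ 2 * n + 1 :=
    (natDegree_sub_le _ _).trans (max_le (natDegree_one_sub_X_sq_mul_le hT) (hPndeg.trans (by omega)))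
  have hEdeg : E.degree < (2 * n : ℕ) := degree_lt_of_X_sq_mul_eq hE hDdeg
  have horth : cardonRobertsInner μ p E = 0 := inner_eq_zero_of_degree_lt hmom hae hEdeg
  -- pointwise identity off the origin
  have hQeval : ∀ x : ℝ, Q.eval x = Pn.eval x + x ^ 2 * E.eval x := by
    intro x
    have := congrArg (fun r : ℝ[X] ↦ r.eval x) hE
    simp only [eval_sub, eval_mul, eval_pow, eval_X] at this
    linarith
  have hQx : ∀ x : ℝ, Q.eval x = 1 - x ^ 2 * T.eval x := fun x ↦ by
    simp [hQ]
  have hPnx : ∀ x : ℝ, Pn.eval x = c * p.eval x := fun x ↦ by rw [hPn, eval_mul, eval_C]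
  have hne : ∀ᵐ x ∂μ, x ≠ 0 := by
    filter_upwards [hgap] with x hx
    intro h0; rw [h0, abs_zero] at hx; linarith
  -- the two integrands and their polynomial difference
  have hlhs : ∀ x : ℝ, (p.eval x / (x * p.eval 0)) ^ 2 = (Pn.eval x / x) ^ 2 := by
    intro x; rw [hPnx, hc]; ring
  have hdiff : ∀ᵐ x ∂μ, ((1 - x ^ 2 * T.eval x) / x) ^ 2 =
      (Pn.eval x / x) ^ 2 + (2 * (Pn * E) + (X * E) * (X * E)).eval x := by
    filter_upwards [hne] with x hx
    rw [← hQx, hQeval]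
    simp only [eval_add, eval_mul, eval_ofNat, eval_X]
    field_simp
    ring
  -- integrability of `(Pn(x)/x)²` : dominated by `Pn(x)²/δ²`
  have hint : Integrable (fun x : ℝ ↦ (Pn.eval x / x) ^ 2) μ := by
    refine Integrable.mono' ((integrable_eval hmom (Pn * Pn)).div_const (δ ^ 2))
      ((Pn.continuous.measurable.div measurable_id).pow_const 2).aestronglyMeasurable ?_
    filter_upwards [hgap] with x hx
    have hδx : δ ^ 2 ≤ |x| ^ 2 := pow_le_pow_left₀ hδ.le hx 2
    rw [Real.norm_eq_abs, abs_of_nonneg (sq_nonneg _), div_pow, ← sq_abs x,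
      show (Pn * Pn).eval x = (Pn.eval x) ^ 2 by rw [eval_mul, pow_two]]
    exact div_le_div_of_nonneg_left (sq_nonneg _) (by positivity) hδx
  have hpoly : Integrable (fun x : ℝ ↦ (2 * (Pn * E) + (X * E) * (X * E)).eval x) μ :=
    integrable_eval hmom _
  calc ∫ x, (p.eval x / (x * p.eval 0)) ^ 2 ∂μ
      = ∫ x, (Pn.eval x / x) ^ 2 ∂μ := by simp_rw [hlhs]
    _ ≤ ∫ x, (Pn.eval x / x) ^ 2 ∂μ + ∫ x, (2 * (Pn * E) + (X * E) * (X * E)).eval x ∂μ := by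
        have h2 : ∫ x, (2 * (Pn * E) + (X * E) * (X * E)).eval x ∂μ =
            2 * (c * cardonRobertsInner μ p E) + cardonRobertsInner μ (X * E) (X * E) := by
          rw [← inner_smul_left, ← inner_smul_left, inner_eq_integral_mul, inner_eq_integral_mul,
            ← integral_add (integrable_eval hmom _) (integrable_eval hmom _)]
          refine integral_congr_ae (Eventually.of_forall fun x ↦ ?_)
          simp only [eval_add, eval_mul, eval_smul, eval_ofNat, smul_eq_mul, hPn, eval_C]
          ring
        rw [h2, horth, mul_zero, mul_zero, zero_add]
        linarith [inner_self_nonneg (μ := μ) (X * E)]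
    _ = ∫ x, ((Pn.eval x / x) ^ 2 + (2 * (Pn * E) + (X * E) * (X * E)).eval x) ∂μ :=
        (integral_add hint hpoly).symm
    _ = ∫ x, ((1 - x ^ 2 * T.eval x) / x) ^ 2 ∂μ := integral_congr_ae (hdiff.mono fun x hx ↦ hx.symm)

/-- **Extremal property of `O_n = p_{2n+1}/(x p'_{2n+1}(0))`** (symmetric `μ` kept at distance
`δ > 0` from the origin): for every polynomial `T` of degree `< 2n`,
`∫ (p_{2n+1}(x)/(x p'_{2n+1}(0)))² dμ ≤ ∫ (1 − x² T(x))² dμ`: here `1 − X²T − O_n = X² E` with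
`deg E < 2n`, the cross term `2∫ x² O_n E dμ = 2 c ⟨p_{2n+1}, X E⟩` vanishes by orthogonality and
the difference is `∫ x⁴ E² dμ ≥ 0`. [cite: CardonRoberts2006, Lemma 3.4 p. 61–62 (tree's substitute road)] -/
theorem integral_oddRatio_sq_le (hmom : ∀ m : ℕ, Integrable (fun x : ℝ ↦ x ^ m) μ)
    (hae : ∀ p : ℝ[X], (fun x : ℝ ↦ p.eval x) =ᵐ[μ] 0 → p = 0)
    (hsym : ∀ p : ℝ[X], ∫ x, p.eval (-x) ∂μ = ∫ x, p.eval x ∂μ)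
    {δ : ℝ} (hδ : 0 < δ) (hgap : ∀ᵐ x ∂μ, δ ≤ |x|) (n : ℕ) (T : ℝ[X])
    (hT : T.degree < (2 * n : ℕ)) :
    ∫ x, ((cardonRobertsPoly μ (2 * n + 1)).eval x /
        (x * (derivative (cardonRobertsPoly μ (2 * n + 1))).eval 0)) ^ 2 ∂μ
      ≤ ∫ x, (1 - x ^ 2 * T.eval x) ^ 2 ∂μ := by
  obtain ⟨Z, hcard, hpos, -, hprod, hder, hderne, -⟩ := exists_oddRatio_eq_prod hmom hae hsym n
  set p := cardonRobertsPoly μ (2 * n + 1) with hp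
  set R : ℝ[X] := ∏ x ∈ Z, (X ^ 2 - C (x ^ 2)) with hR
  have hR0 : R.eval 0 = (derivative p).eval 0 := by rw [hder, hR, eval_zero_prod_X_sq_sub]
  set c : ℝ := ((derivative p).eval 0)⁻¹ with hc
  set On : ℝ[X] := C c * R with hOn
  set Q : ℝ[X] := 1 - X ^ 2 * T with hQ
  have hR1 : R.coeff 1 = 0 := coeff_one_prod_X_sq_sub Z
  have hdvd : (X : ℝ[X]) ^ 2 ∣ Q - On := by
    rw [X_pow_dvd_iff]
    intro d hd
    interval_cases d
    · rw [coeff_sub, hQ, hOn, coeff_sub, coeff_one_zero, coeff_X_pow_mul', if_neg (by omega),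
        sub_zero, coeff_C_mul, coeff_zero_eq_eval_zero, hR0, hc, inv_mul_cancel₀ hderne, sub_self]
    · rw [coeff_sub, hQ, hOn, coeff_sub, coeff_one, if_neg one_ne_zero, coeff_X_pow_mul',
        if_neg (by omega), sub_zero, coeff_C_mul, hR1, mul_zero, sub_zero]
  obtain ⟨E, hE⟩ := hdvd
  have hOndeg : On.natDegree ≤ 2 * n := by
    rw [hOn]
    refine (natDegree_C_mul_le _ _).trans ?_
    rw [hR, natDegree_prod_X_sq_sub, hcard]
  have hDdeg : (Q - On).natDegree ≤ 2 * n + 1 :=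
    (natDegree_sub_le _ _).trans (max_le (natDegree_one_sub_X_sq_mul_le hT) (hOndeg.trans (by omega)))
  have hEdeg : E.degree < (2 * n : ℕ) := degree_lt_of_X_sq_mul_eq hE hDdeg
  -- orthogonality: `⟨p, X E⟩ = 0` since `deg (X E) < 2n + 1`
  have hXEdeg : (X * E : ℝ[X]).degree < (2 * n + 1 : ℕ) := by
    by_cases hE0 : E = 0
    · rw [hE0, mul_zero, degree_zero]; exact WithBot.bot_lt_coe _
    · have hEn : E.natDegree < 2 * n := (natDegree_lt_iff_degree_lt hE0).2 hEdeg
      rw [degree_eq_natDegree (mul_ne_zero X_ne_zero hE0), natDegree_mul X_ne_zero hE0,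
        natDegree_X]
      exact_mod_cast (by omega : 1 + E.natDegree < 2 * n + 1)
  have horth : cardonRobertsInner μ p (X * E) = 0 := inner_eq_zero_of_degree_lt hmom hae hXEdeg
  -- pointwise identities
  have hQeval : ∀ x : ℝ, Q.eval x = On.eval x + x ^ 2 * E.eval x := by
    intro x
    have := congrArg (fun r : ℝ[X] ↦ r.eval x) hE
    simp only [eval_sub, eval_mul, eval_pow, eval_X] at this
    linarith
  have hQx : ∀ x : ℝ, Q.eval x = 1 - x ^ 2 * T.eval x := fun x ↦ by simp [hQ]
  have hpx : ∀ x : ℝ, p.eval x = x * R.eval x := fun x ↦ by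
    rw [hprod, eval_mul, eval_X]
  have hOnx : ∀ x : ℝ, On.eval x = c * R.eval x := fun x ↦ by rw [hOn, eval_mul, eval_C]
  have hne : ∀ᵐ x ∂μ, x ≠ 0 := by
    filter_upwards [hgap] with x hx
    intro h0; rw [h0, abs_zero] at hx; linarith
  have hlhs : ∀ᵐ x ∂μ, (p.eval x / (x * (derivative p).eval 0)) ^ 2 = (On * On).eval x := by
    filter_upwards [hne] with x hx
    rw [hpx, eval_mul, hOnx, hc, mul_div_mul_left _ _ hx]
    ring
  have hrhs : ∀ x : ℝ, (1 - x ^ 2 * T.eval x) ^ 2 =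
      (On * On + (2 * (X * (C c * p) * E) + (X ^ 2 * E) * (X ^ 2 * E))).eval x := by
    intro x
    rw [← hQx, hQeval]
    simp only [eval_add, eval_mul, eval_ofNat, eval_X, eval_pow, eval_C, hpx, hOnx]
    ring
  calc ∫ x, (p.eval x / (x * (derivative p).eval 0)) ^ 2 ∂μ
      = ∫ x, (On * On).eval x ∂μ := integral_congr_ae hlhs
    _ ≤ ∫ x, (On * On).eval x ∂μ +
          ∫ x, (2 * (X * (C c * p) * E) + (X ^ 2 * E) * (X ^ 2 * E)).eval x ∂μ := by
        have h2 : ∫ x, (2 * (X * (C c * p) * E) + (X ^ 2 * E) * (X ^ 2 * E)).eval x ∂μ =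
            2 * (c * cardonRobertsInner μ p (X * E)) +
              cardonRobertsInner μ (X ^ 2 * E) (X ^ 2 * E) := by
          rw [← inner_smul_left, ← inner_smul_left, inner_eq_integral_mul, inner_eq_integral_mul,
            ← integral_add (integrable_eval hmom _) (integrable_eval hmom _)]
          refine integral_congr_ae (Eventually.of_forall fun x ↦ ?_)
          simp only [eval_add, eval_mul, eval_smul, eval_ofNat, smul_eq_mul, eval_C, eval_X,
            eval_pow]
          ring
        rw [h2, horth, mul_zero, mul_zero, zero_add]
        linarith [inner_self_nonneg (μ := μ) (X ^ 2 * E)]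
    _ = ∫ x, (On * On + (2 * (X * (C c * p) * E) + (X ^ 2 * E) * (X ^ 2 * E))).eval x ∂μ := by
        rw [← integral_add (integrable_eval hmom _) (integrable_eval hmom _)]
        refine integral_congr_ae (Eventually.of_forall fun x ↦ ?_)
        simp only [eval_add]
    _ = ∫ x, (1 - x ^ 2 * T.eval x) ^ 2 ∂μ := by
        refine integral_congr_ae ?_
        exact Eventually.of_forall fun x ↦ (hrhs x).symm

end CardonRobertsOP

end Literature.NumberTheory.LFunctions

end
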